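import Summits.Ventures.CertifiedManyBodySolver.Observables.SourcedGibbsTrialCapAFFermi
import Summits.Ventures.CertifiedManyBodySolver.Observables.SourcedGibbsTrialCapPlaneWaveResolution
import HarnessLib

/-!
# The HF–BCS sourced cap in momentum space (XIV-a): the DIAGONAL (same-site) entries of the Fermi matrix of the
# antiferromagnetic + `d`-wave-pinned torus as momentum sums — uniform part plus `(−1)^x` × staggered part

HONEST FRAMING: zero compute; PROVED finite-volume identities about the Fermi matrix `F = (1 + e^{β𝓗})⁻¹` of the Nambu matrix
of the spin-density-wave + `d`-wave-pinned quasi-free TRIAL Hamiltonian (files (VIII), (X), (XIII-b)); no number is claimed; the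
staggered field is a variational device; not a statement about order; not a superconductivity verdict.

Cell `hubbard-obs` (D-0042 / D-0082), seat `hubbard-obs-pin-2` (`prover-hubbard-obs-pin-2-g7-0`). By the plane-wave resolution
(file (XII)) and the closed-form plane-wave action (file (XIII-b)), for every site `x` and `σ, σ' ∈ {↑, ↓}`:
`F((x,σ),(x,σ')) = L⁻² Σ_p [c_{σσ'}(p) + (−1)^x s_{σσ'}(p)]` with the eight real coefficient functions of file (XIII-b)
(`χ_p(−x)χ_p(x) = 1`, `χ_p(−x)χ_{p+Q}(x) = (−1)^x`). These are the one-body inputs of the generalized-Hartree–Fock cap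
`groundEnergy_dWaveSourceTorus_le_HFBCS_spinField` (densities, double occupancy, spin-field term).

* `torusChar_neg_mul_self`, `torusChar_neg_mul_neel`, `planeWaveComb_resolve_zero/one`, `afNambu_planeWaveComb_resolve_zero/one`
  — structural lemmas: reading the `χ_p ⊗ e_σ` / `χ_{p+Q} ⊗ e_σ` coefficients of a four-term plane-wave combination (and of
  `𝓗` applied to it) at a site, against `χ_p(−x)`.
* `fermi_afNambu_diag_zero_zero / one_zero / zero_one / one_one` — the four diagonal entries.

References: Bach–Lieb–Solovej, J. Stat. Phys. 76 (1994) 3, §2 [BachLiebSolovej1994]; J. E. Hirsch, Phys. Rev. B 31 (1985) 4403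
[HirschPRB1985]; S. Friedli, Y. Velenik (2017) §10.4 [FriedliVelenik2017].
-/

noncomputable section

open Matrix Finset Literature.MathematicalPhysics.QuantumLattice Literature.Probability.LatticeModels
open scoped ComplexConjugate

namespace Summit.Ventures.CertifiedManyBodySolver.Observables

section AFDiag

variable (k : ℕ) [NeZero (2 * k)]

/-- `χ_p(−z) χ_p(z) = 1`. [folklore] -/
theorem torusChar_neg_mul_self (p z : TorusSite 2 (2 * k)) : torusChar p (-z) * torusChar p z = 1 := by
  rw [← torusChar_add_right, neg_add_cancel, torusChar_zero_right]

/-- `χ_p(−z) χ_{p+Q}(z) = (−1)^z`. [folklore] -/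
theorem torusChar_neg_mul_neel (p z : TorusSite 2 (2 * k)) :
    torusChar p (-z) * torusChar (p + neelIndex (2 * k)) z = (neelSign z : ℂ) := by
  rw [torusChar_add_neelIndex' k, mul_left_comm, torusChar_neg_mul_self, mul_one]

/-- Reading the `↑`-component of a four-term plane-wave combination at site `x` against `χ_p(−x)`:
`χ_p(−x)·(a χ_p⊗e_↑ + b χ_p⊗e_↓ + c χ_{p+Q}⊗e_↑ + d χ_{p+Q}⊗e_↓)(x,↑) = a + (−1)^x c`. [folklore] -/
theorem planeWaveComb_resolve_zero (p : TorusSite 2 (2 * k)) (x : FermionTorus 2 (2 * k)) (a b c d : ℂ) :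
    torusChar p (-x.toTorusSite) * (a • planeWave p 0 + b • planeWave p 1 + c • planeWave (p + neelIndex (2 * k)) 0 +
        d • planeWave (p + neelIndex (2 * k)) 1 : Orb (FermionTorus 2 (2 * k)) → ℂ) (orb x 0) =
      a + (neelSign x.toTorusSite : ℂ) * c := by
  simp only [Pi.add_apply, Pi.smul_apply, smul_eq_mul, planeWave_orb, if_true, zero_ne_one, if_false, mul_zero, add_zero]
  linear_combination a * torusChar_neg_mul_self k p x.toTorusSite + c * torusChar_neg_mul_neel k p x.toTorusSite

/-- The `↓`-component: `χ_p(−x)·(a χ_p⊗e_↑ + b χ_p⊗e_↓ + c χ_{p+Q}⊗e_↑ + d χ_{p+Q}⊗e_↓)(x,↓) = b + (−1)^x d`. [folklore] -/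
theorem planeWaveComb_resolve_one (p : TorusSite 2 (2 * k)) (x : FermionTorus 2 (2 * k)) (a b c d : ℂ) :
    torusChar p (-x.toTorusSite) * (a • planeWave p 0 + b • planeWave p 1 + c • planeWave (p + neelIndex (2 * k)) 0 +
        d • planeWave (p + neelIndex (2 * k)) 1 : Orb (FermionTorus 2 (2 * k)) → ℂ) (orb x 1) =
      b + (neelSign x.toTorusSite : ℂ) * d := by
  simp only [Pi.add_apply, Pi.smul_apply, smul_eq_mul, planeWave_orb, one_ne_zero, if_false, if_true, mul_zero, zero_add]
  linear_combination b * torusChar_neg_mul_self k p x.toTorusSite + d * torusChar_neg_mul_neel k p x.toTorusSite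

/-- **`𝓗` on a four-term plane-wave combination, read at `(x,↑)` against `χ_p(−x)`**:
`= (aξ_p + bG_p + cM) + (−1)^x (aM + cξ_{p+Q} + dG_{p+Q})`, `ξ_{p+Q} = −ε_p − μ'`, `G_{p+Q} = −G_p` (file (X), `2k ≥ 3`).
[cite: BachLiebSolovej1994, §2] [cite: HirschPRB1985] -/
theorem afNambu_planeWaveComb_resolve_zero (hL : 3 ≤ 2 * k) (μ' h M : ℝ) (p : TorusSite 2 (2 * k))
    (x : FermionTorus 2 (2 * k)) (a b c d : ℂ) :
    torusChar p (-x.toTorusSite) * ((bdgNambuMatrix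
        (fun x y => if (fermionTorusGraph 2 (2 * k)).Adj x y then -(1 : ℂ) else 0)
        (fun u v : FermionTorus 2 (2 * k) => -(h : ℂ) * ∑ i : Fin 2,
          if v = FermionTorus.ofTorusSite (u.toTorusSite + Pi.single i 1) then
            ((Real.sqrt 2 * (if i = 0 then 1 else -1) : ℝ) : ℂ) else 0) μ' +
      diagonal fun i : Orb (FermionTorus 2 (2 * k)) => ((M * neelSign ((ofLex i).1.toTorusSite) : ℝ) : ℂ)) *ᵥ
      (a • planeWave p 0 + b • planeWave p 1 + c • planeWave (p + neelIndex (2 * k)) 0 +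
        d • planeWave (p + neelIndex (2 * k)) 1 : Orb (FermionTorus 2 (2 * k)) → ℂ)) (orb x 0) =
      (a * ((torusBand (2 * k) p - μ' : ℝ) : ℂ) + b * ((2 * Real.sqrt 2 * h * dWaveGap p : ℝ) : ℂ) + c * (M : ℂ)) +
        (neelSign x.toTorusSite : ℂ) *
          (a * (M : ℂ) + c * ((-torusBand (2 * k) p - μ' : ℝ) : ℂ) + d * ((2 * Real.sqrt 2 * h * -dWaveGap p : ℝ) : ℂ)) := by
  simp only [Matrix.mulVec_add, Matrix.mulVec_smul, afNambu_mulVec_planeWave_zero k hL μ' h M p,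
    afNambu_mulVec_planeWave_one k hL μ' h M p, afNambu_mulVec_planeWave_zero k hL μ' h M (p + neelIndex (2 * k)),
    afNambu_mulVec_planeWave_one k hL μ' h M (p + neelIndex (2 * k)), torusBand_add_neelIndex, dWaveGap_add_neelIndex,
    add_neelIndex_add_neelIndex]
  simp only [Pi.add_apply, Pi.sub_apply, Pi.smul_apply, smul_eq_mul, planeWave_orb, if_true, zero_ne_one, if_false, mul_zero,
    add_zero, sub_zero]
  linear_combination (a * ((torusBand (2 * k) p - μ' : ℝ) : ℂ) + b * ((2 * Real.sqrt 2 * h * dWaveGap p : ℝ) : ℂ) +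
      c * (M : ℂ)) * torusChar_neg_mul_self k p x.toTorusSite +
    (a * (M : ℂ) + c * ((-torusBand (2 * k) p - μ' : ℝ) : ℂ) + d * ((2 * Real.sqrt 2 * h * -dWaveGap p : ℝ) : ℂ)) *
      torusChar_neg_mul_neel k p x.toTorusSite

/-- **`𝓗` on a four-term plane-wave combination, read at `(x,↓)` against `χ_p(−x)`**:
`= (aG_p − bξ_p + dM) + (−1)^x (bM + cG_{p+Q} − dξ_{p+Q})`. [cite: BachLiebSolovej1994, §2] [cite: HirschPRB1985] -/
theorem afNambu_planeWaveComb_resolve_one (hL : 3 ≤ 2 * k) (μ' h M : ℝ) (p : TorusSite 2 (2 * k))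
    (x : FermionTorus 2 (2 * k)) (a b c d : ℂ) :
    torusChar p (-x.toTorusSite) * ((bdgNambuMatrix
        (fun x y => if (fermionTorusGraph 2 (2 * k)).Adj x y then -(1 : ℂ) else 0)
        (fun u v : FermionTorus 2 (2 * k) => -(h : ℂ) * ∑ i : Fin 2,
          if v = FermionTorus.ofTorusSite (u.toTorusSite + Pi.single i 1) then
            ((Real.sqrt 2 * (if i = 0 then 1 else -1) : ℝ) : ℂ) else 0) μ' +
      diagonal fun i : Orb (FermionTorus 2 (2 * k)) => ((M * neelSign ((ofLex i).1.toTorusSite) : ℝ) : ℂ)) *ᵥ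
      (a • planeWave p 0 + b • planeWave p 1 + c • planeWave (p + neelIndex (2 * k)) 0 +
        d • planeWave (p + neelIndex (2 * k)) 1 : Orb (FermionTorus 2 (2 * k)) → ℂ)) (orb x 1) =
      (a * ((2 * Real.sqrt 2 * h * dWaveGap p : ℝ) : ℂ) - b * ((torusBand (2 * k) p - μ' : ℝ) : ℂ) + d * (M : ℂ)) +
        (neelSign x.toTorusSite : ℂ) *
          (b * (M : ℂ) + c * ((2 * Real.sqrt 2 * h * -dWaveGap p : ℝ) : ℂ) - d * ((-torusBand (2 * k) p - μ' : ℝ) : ℂ)) := by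
  simp only [Matrix.mulVec_add, Matrix.mulVec_smul, afNambu_mulVec_planeWave_zero k hL μ' h M p,
    afNambu_mulVec_planeWave_one k hL μ' h M p, afNambu_mulVec_planeWave_zero k hL μ' h M (p + neelIndex (2 * k)),
    afNambu_mulVec_planeWave_one k hL μ' h M (p + neelIndex (2 * k)), torusBand_add_neelIndex, dWaveGap_add_neelIndex,
    add_neelIndex_add_neelIndex]
  simp only [Pi.add_apply, Pi.sub_apply, Pi.smul_apply, smul_eq_mul, planeWave_orb, one_ne_zero, if_false, if_true, mul_zero,
    zero_add, add_zero, zero_sub]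
  linear_combination (a * ((2 * Real.sqrt 2 * h * dWaveGap p : ℝ) : ℂ) - b * ((torusBand (2 * k) p - μ' : ℝ) : ℂ) +
      d * (M : ℂ)) * torusChar_neg_mul_self k p x.toTorusSite +
    (b * (M : ℂ) + c * ((2 * Real.sqrt 2 * h * -dWaveGap p : ℝ) : ℂ) - d * ((-torusBand (2 * k) p - μ' : ℝ) : ℂ)) *
      torusChar_neg_mul_neel k p x.toTorusSite

/-- **Diagonal Fermi-matrix entry `(x↑, x↑)`** of the antiferromagnetic + `d`-wave-pinned torus:
`F((x,σ),(x,σ')) = L⁻² Σ_p [c(p) + (−1)^x s(p)]` with the closed-form `c, s` of file (XIII-b) (`2k ≥ 3`).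
[cite: BachLiebSolovej1994, §2] [cite: HirschPRB1985] -/
theorem fermi_afNambu_diag_zero_zero (hL : 3 ≤ 2 * k) (μ' h M β : ℝ) (x : FermionTorus 2 (2 * k)) :
    (1 + NormedSpace.exp ((β : ℂ) • (bdgNambuMatrix
        (fun x y => if (fermionTorusGraph 2 (2 * k)).Adj x y then -(1 : ℂ) else 0)
        (fun u v : FermionTorus 2 (2 * k) => -(h : ℂ) * ∑ i : Fin 2,
          if v = FermionTorus.ofTorusSite (u.toTorusSite + Pi.single i 1) then
            ((Real.sqrt 2 * (if i = 0 then 1 else -1) : ℝ) : ℂ) else 0) μ' +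
      diagonal fun i : Orb (FermionTorus 2 (2 * k)) => ((M * neelSign ((ofLex i).1.toTorusSite) : ℝ) : ℂ))))⁻¹ (orb x 0) (orb x 0) =
      (((2 * k : ℕ) : ℂ) ^ 2)⁻¹ * ∑ p : TorusSite 2 (2 * k),
        ((((1 / 2 -
          Real.tanh (β * Real.sqrt ((Real.sqrt (torusBand (2 * k) p ^ 2 + M ^ 2) + |μ'|) ^ 2 + (2 * Real.sqrt 2 * h * dWaveGap p) ^ 2) / 2) /
              (2 * Real.sqrt ((Real.sqrt (torusBand (2 * k) p ^ 2 + M ^ 2) + |μ'|) ^ 2 + (2 * Real.sqrt 2 * h * dWaveGap p) ^ 2)) *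
            ((torusBand (2 * k) p - μ') / 2 - μ' / (2 * |μ'| * Real.sqrt (torusBand (2 * k) p ^ 2 + M ^ 2)) *
              (torusBand (2 * k) p ^ 2 + M ^ 2 - torusBand (2 * k) p * μ')) -
          Real.tanh (β * Real.sqrt ((Real.sqrt (torusBand (2 * k) p ^ 2 + M ^ 2) - |μ'|) ^ 2 + (2 * Real.sqrt 2 * h * dWaveGap p) ^ 2) / 2) /
              (2 * Real.sqrt ((Real.sqrt (torusBand (2 * k) p ^ 2 + M ^ 2) - |μ'|) ^ 2 + (2 * Real.sqrt 2 * h * dWaveGap p) ^ 2)) *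
            ((torusBand (2 * k) p - μ') / 2 + μ' / (2 * |μ'| * Real.sqrt (torusBand (2 * k) p ^ 2 + M ^ 2)) *
              (torusBand (2 * k) p ^ 2 + M ^ 2 - torusBand (2 * k) p * μ'))) : ℝ) : ℂ) + (neelSign x.toTorusSite : ℂ) * (((-M *
          (Real.tanh (β * Real.sqrt ((Real.sqrt (torusBand (2 * k) p ^ 2 + M ^ 2) + |μ'|) ^ 2 + (2 * Real.sqrt 2 * h * dWaveGap p) ^ 2) / 2) /
              (2 * Real.sqrt ((Real.sqrt (torusBand (2 * k) p ^ 2 + M ^ 2) + |μ'|) ^ 2 + (2 * Real.sqrt 2 * h * dWaveGap p) ^ 2)) *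
            (1 / 2 + μ' / (2 * |μ'| * Real.sqrt (torusBand (2 * k) p ^ 2 + M ^ 2)) * μ') +
          Real.tanh (β * Real.sqrt ((Real.sqrt (torusBand (2 * k) p ^ 2 + M ^ 2) - |μ'|) ^ 2 + (2 * Real.sqrt 2 * h * dWaveGap p) ^ 2) / 2) /
              (2 * Real.sqrt ((Real.sqrt (torusBand (2 * k) p ^ 2 + M ^ 2) - |μ'|) ^ 2 + (2 * Real.sqrt 2 * h * dWaveGap p) ^ 2)) *
            (1 / 2 - μ' / (2 * |μ'| * Real.sqrt (torusBand (2 * k) p ^ 2 + M ^ 2)) * μ'))) : ℝ) : ℂ)) := by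
  refine (apply_orb_eq_sum_mulVec_planeWave _ (orb x 0) x 0).trans ?_
  congr 1
  refine Finset.sum_congr rfl fun p _ => ?_
  rw [fermi_afNambu_mulVec_planeWave_zero k hL μ' h M β p, planeWaveComb_resolve_zero]

/-- **Diagonal Fermi-matrix entry `(x↓, x↑)`** of the antiferromagnetic + `d`-wave-pinned torus:
`F((x,σ),(x,σ')) = L⁻² Σ_p [c(p) + (−1)^x s(p)]` with the closed-form `c, s` of file (XIII-b) (`2k ≥ 3`).
[cite: BachLiebSolovej1994, §2] [cite: HirschPRB1985] -/
theorem fermi_afNambu_diag_one_zero (hL : 3 ≤ 2 * k) (μ' h M β : ℝ) (x : FermionTorus 2 (2 * k)) :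
    (1 + NormedSpace.exp ((β : ℂ) • (bdgNambuMatrix
        (fun x y => if (fermionTorusGraph 2 (2 * k)).Adj x y then -(1 : ℂ) else 0)
        (fun u v : FermionTorus 2 (2 * k) => -(h : ℂ) * ∑ i : Fin 2,
          if v = FermionTorus.ofTorusSite (u.toTorusSite + Pi.single i 1) then
            ((Real.sqrt 2 * (if i = 0 then 1 else -1) : ℝ) : ℂ) else 0) μ' +
      diagonal fun i : Orb (FermionTorus 2 (2 * k)) => ((M * neelSign ((ofLex i).1.toTorusSite) : ℝ) : ℂ))))⁻¹ (orb x 1) (orb x 0) =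
      (((2 * k : ℕ) : ℂ) ^ 2)⁻¹ * ∑ p : TorusSite 2 (2 * k),
        ((((-(2 * Real.sqrt 2 * h * dWaveGap p) *
          (Real.tanh (β * Real.sqrt ((Real.sqrt (torusBand (2 * k) p ^ 2 + M ^ 2) + |μ'|) ^ 2 + (2 * Real.sqrt 2 * h * dWaveGap p) ^ 2) / 2) /
              (2 * Real.sqrt ((Real.sqrt (torusBand (2 * k) p ^ 2 + M ^ 2) + |μ'|) ^ 2 + (2 * Real.sqrt 2 * h * dWaveGap p) ^ 2)) *
            (1 / 2 - μ' / (2 * |μ'| * Real.sqrt (torusBand (2 * k) p ^ 2 + M ^ 2)) * torusBand (2 * k) p) +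
          Real.tanh (β * Real.sqrt ((Real.sqrt (torusBand (2 * k) p ^ 2 + M ^ 2) - |μ'|) ^ 2 + (2 * Real.sqrt 2 * h * dWaveGap p) ^ 2) / 2) /
              (2 * Real.sqrt ((Real.sqrt (torusBand (2 * k) p ^ 2 + M ^ 2) - |μ'|) ^ 2 + (2 * Real.sqrt 2 * h * dWaveGap p) ^ 2)) *
            (1 / 2 + μ' / (2 * |μ'| * Real.sqrt (torusBand (2 * k) p ^ 2 + M ^ 2)) * torusBand (2 * k) p))) : ℝ) : ℂ) + (neelSign x.toTorusSite : ℂ) * (((-(μ' / (2 * |μ'| * Real.sqrt (torusBand (2 * k) p ^ 2 + M ^ 2))) * M * (2 * Real.sqrt 2 * h * dWaveGap p) *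
          (Real.tanh (β * Real.sqrt ((Real.sqrt (torusBand (2 * k) p ^ 2 + M ^ 2) + |μ'|) ^ 2 + (2 * Real.sqrt 2 * h * dWaveGap p) ^ 2) / 2) /
              (2 * Real.sqrt ((Real.sqrt (torusBand (2 * k) p ^ 2 + M ^ 2) + |μ'|) ^ 2 + (2 * Real.sqrt 2 * h * dWaveGap p) ^ 2)) -
            Real.tanh (β * Real.sqrt ((Real.sqrt (torusBand (2 * k) p ^ 2 + M ^ 2) - |μ'|) ^ 2 + (2 * Real.sqrt 2 * h * dWaveGap p) ^ 2) / 2) /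
              (2 * Real.sqrt ((Real.sqrt (torusBand (2 * k) p ^ 2 + M ^ 2) - |μ'|) ^ 2 + (2 * Real.sqrt 2 * h * dWaveGap p) ^ 2)))) : ℝ) : ℂ)) := by
  refine (apply_orb_eq_sum_mulVec_planeWave _ (orb x 1) x 0).trans ?_
  congr 1
  refine Finset.sum_congr rfl fun p _ => ?_
  rw [fermi_afNambu_mulVec_planeWave_zero k hL μ' h M β p, planeWaveComb_resolve_one]
  push_cast
  ring

/-- **Diagonal Fermi-matrix entry `(x↑, x↓)`** of the antiferromagnetic + `d`-wave-pinned torus: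
`F((x,σ),(x,σ')) = L⁻² Σ_p [c(p) + (−1)^x s(p)]` with the closed-form `c, s` of file (XIII-b) (`2k ≥ 3`).
[cite: BachLiebSolovej1994, §2] [cite: HirschPRB1985] -/
theorem fermi_afNambu_diag_zero_one (hL : 3 ≤ 2 * k) (μ' h M β : ℝ) (x : FermionTorus 2 (2 * k)) :
    (1 + NormedSpace.exp ((β : ℂ) • (bdgNambuMatrix
        (fun x y => if (fermionTorusGraph 2 (2 * k)).Adj x y then -(1 : ℂ) else 0)
        (fun u v : FermionTorus 2 (2 * k) => -(h : ℂ) * ∑ i : Fin 2,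
          if v = FermionTorus.ofTorusSite (u.toTorusSite + Pi.single i 1) then
            ((Real.sqrt 2 * (if i = 0 then 1 else -1) : ℝ) : ℂ) else 0) μ' +
      diagonal fun i : Orb (FermionTorus 2 (2 * k)) => ((M * neelSign ((ofLex i).1.toTorusSite) : ℝ) : ℂ))))⁻¹ (orb x 0) (orb x 1) =
      (((2 * k : ℕ) : ℂ) ^ 2)⁻¹ * ∑ p : TorusSite 2 (2 * k),
        ((((-(2 * Real.sqrt 2 * h * dWaveGap p) *
          (Real.tanh (β * Real.sqrt ((Real.sqrt (torusBand (2 * k) p ^ 2 + M ^ 2) + |μ'|) ^ 2 + (2 * Real.sqrt 2 * h * dWaveGap p) ^ 2) / 2) /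
              (2 * Real.sqrt ((Real.sqrt (torusBand (2 * k) p ^ 2 + M ^ 2) + |μ'|) ^ 2 + (2 * Real.sqrt 2 * h * dWaveGap p) ^ 2)) *
            (1 / 2 - μ' / (2 * |μ'| * Real.sqrt (torusBand (2 * k) p ^ 2 + M ^ 2)) * torusBand (2 * k) p) +
          Real.tanh (β * Real.sqrt ((Real.sqrt (torusBand (2 * k) p ^ 2 + M ^ 2) - |μ'|) ^ 2 + (2 * Real.sqrt 2 * h * dWaveGap p) ^ 2) / 2) /
              (2 * Real.sqrt ((Real.sqrt (torusBand (2 * k) p ^ 2 + M ^ 2) - |μ'|) ^ 2 + (2 * Real.sqrt 2 * h * dWaveGap p) ^ 2)) *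
            (1 / 2 + μ' / (2 * |μ'| * Real.sqrt (torusBand (2 * k) p ^ 2 + M ^ 2)) * torusBand (2 * k) p))) : ℝ) : ℂ) + (neelSign x.toTorusSite : ℂ) * (((μ' / (2 * |μ'| * Real.sqrt (torusBand (2 * k) p ^ 2 + M ^ 2)) * M * (2 * Real.sqrt 2 * h * dWaveGap p) *
          (Real.tanh (β * Real.sqrt ((Real.sqrt (torusBand (2 * k) p ^ 2 + M ^ 2) + |μ'|) ^ 2 + (2 * Real.sqrt 2 * h * dWaveGap p) ^ 2) / 2) /
              (2 * Real.sqrt ((Real.sqrt (torusBand (2 * k) p ^ 2 + M ^ 2) + |μ'|) ^ 2 + (2 * Real.sqrt 2 * h * dWaveGap p) ^ 2)) -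
            Real.tanh (β * Real.sqrt ((Real.sqrt (torusBand (2 * k) p ^ 2 + M ^ 2) - |μ'|) ^ 2 + (2 * Real.sqrt 2 * h * dWaveGap p) ^ 2) / 2) /
              (2 * Real.sqrt ((Real.sqrt (torusBand (2 * k) p ^ 2 + M ^ 2) - |μ'|) ^ 2 + (2 * Real.sqrt 2 * h * dWaveGap p) ^ 2)))) : ℝ) : ℂ)) := by
  refine (apply_orb_eq_sum_mulVec_planeWave _ (orb x 0) x 1).trans ?_
  congr 1
  refine Finset.sum_congr rfl fun p _ => ?_
  rw [fermi_afNambu_mulVec_planeWave_one k hL μ' h M β p, planeWaveComb_resolve_zero]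

/-- **Diagonal Fermi-matrix entry `(x↓, x↓)`** of the antiferromagnetic + `d`-wave-pinned torus:
`F((x,σ),(x,σ')) = L⁻² Σ_p [c(p) + (−1)^x s(p)]` with the closed-form `c, s` of file (XIII-b) (`2k ≥ 3`).
[cite: BachLiebSolovej1994, §2] [cite: HirschPRB1985] -/
theorem fermi_afNambu_diag_one_one (hL : 3 ≤ 2 * k) (μ' h M β : ℝ) (x : FermionTorus 2 (2 * k)) :
    (1 + NormedSpace.exp ((β : ℂ) • (bdgNambuMatrix
        (fun x y => if (fermionTorusGraph 2 (2 * k)).Adj x y then -(1 : ℂ) else 0)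
        (fun u v : FermionTorus 2 (2 * k) => -(h : ℂ) * ∑ i : Fin 2,
          if v = FermionTorus.ofTorusSite (u.toTorusSite + Pi.single i 1) then
            ((Real.sqrt 2 * (if i = 0 then 1 else -1) : ℝ) : ℂ) else 0) μ' +
      diagonal fun i : Orb (FermionTorus 2 (2 * k)) => ((M * neelSign ((ofLex i).1.toTorusSite) : ℝ) : ℂ))))⁻¹ (orb x 1) (orb x 1) =
      (((2 * k : ℕ) : ℂ) ^ 2)⁻¹ * ∑ p : TorusSite 2 (2 * k),
        ((((1 / 2 +
          Real.tanh (β * Real.sqrt ((Real.sqrt (torusBand (2 * k) p ^ 2 + M ^ 2) + |μ'|) ^ 2 + (2 * Real.sqrt 2 * h * dWaveGap p) ^ 2) / 2) /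
              (2 * Real.sqrt ((Real.sqrt (torusBand (2 * k) p ^ 2 + M ^ 2) + |μ'|) ^ 2 + (2 * Real.sqrt 2 * h * dWaveGap p) ^ 2)) *
            ((torusBand (2 * k) p - μ') / 2 - μ' / (2 * |μ'| * Real.sqrt (torusBand (2 * k) p ^ 2 + M ^ 2)) *
              (torusBand (2 * k) p ^ 2 + M ^ 2 - torusBand (2 * k) p * μ')) +
          Real.tanh (β * Real.sqrt ((Real.sqrt (torusBand (2 * k) p ^ 2 + M ^ 2) - |μ'|) ^ 2 + (2 * Real.sqrt 2 * h * dWaveGap p) ^ 2) / 2) /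
              (2 * Real.sqrt ((Real.sqrt (torusBand (2 * k) p ^ 2 + M ^ 2) - |μ'|) ^ 2 + (2 * Real.sqrt 2 * h * dWaveGap p) ^ 2)) *
            ((torusBand (2 * k) p - μ') / 2 + μ' / (2 * |μ'| * Real.sqrt (torusBand (2 * k) p ^ 2 + M ^ 2)) *
              (torusBand (2 * k) p ^ 2 + M ^ 2 - torusBand (2 * k) p * μ'))) : ℝ) : ℂ) + (neelSign x.toTorusSite : ℂ) * (((-M *
          (Real.tanh (β * Real.sqrt ((Real.sqrt (torusBand (2 * k) p ^ 2 + M ^ 2) + |μ'|) ^ 2 + (2 * Real.sqrt 2 * h * dWaveGap p) ^ 2) / 2) /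
              (2 * Real.sqrt ((Real.sqrt (torusBand (2 * k) p ^ 2 + M ^ 2) + |μ'|) ^ 2 + (2 * Real.sqrt 2 * h * dWaveGap p) ^ 2)) *
            (1 / 2 + μ' / (2 * |μ'| * Real.sqrt (torusBand (2 * k) p ^ 2 + M ^ 2)) * μ') +
          Real.tanh (β * Real.sqrt ((Real.sqrt (torusBand (2 * k) p ^ 2 + M ^ 2) - |μ'|) ^ 2 + (2 * Real.sqrt 2 * h * dWaveGap p) ^ 2) / 2) /
              (2 * Real.sqrt ((Real.sqrt (torusBand (2 * k) p ^ 2 + M ^ 2) - |μ'|) ^ 2 + (2 * Real.sqrt 2 * h * dWaveGap p) ^ 2)) *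
            (1 / 2 - μ' / (2 * |μ'| * Real.sqrt (torusBand (2 * k) p ^ 2 + M ^ 2)) * μ'))) : ℝ) : ℂ)) := by
  refine (apply_orb_eq_sum_mulVec_planeWave _ (orb x 1) x 1).trans ?_
  congr 1
  refine Finset.sum_congr rfl fun p _ => ?_
  rw [fermi_afNambu_mulVec_planeWave_one k hL μ' h M β p, planeWaveComb_resolve_one]

end AFDiag

end Summit.Ventures.CertifiedManyBodySolver.Observables

end
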